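/-
Copyright (c) 2026. All rights reserved.
Released under Apache 2.0 license as described in the file LICENSE.
Authors: abc-iut cell — seat abc-iut-L4-t8 (gen 9; proof-only companion of `HolomorphicCores.lean`,
typed by abc-iut-L4-t2 / abc-iut-L4-t14; L4-lead m110/m113 closers (b1) and (f) of [AbsTopIII] Cor 2.4).
-/
import Literature.AnabelianGeometry.AbsoluteAnabelian.HyperbolicCurveHyperbolicCoreUnconditional
import Literature.AnabelianGeometry.AbsoluteAnabelian.AbsTopIII.RemarksArchimedeanLocalProofs
import Literature.Topology.CoveringSpaces.CoveringCompSimplyConnected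
import Literature.Topology.CoveringSpaces.CoveringPreimageComponent
import Mathlib.GroupTheory.Commensurable
import Mathlib.GroupTheory.Index
import HarnessLib

/-!
# Proof-only companion of `HolomorphicCores`: the lifted structure and the functoriality clause of [AbsTopIII] Cor 2.4

S. Mochizuki, *Topics in absolute anabelian geometry III*, Cor 2.4 (kurims pp.54–55).  Two printed
items of the corollary that the tree had not closed (L4-lead m110/m113, node `AbsTopIII:Cor2.4`):

* **(b), first sentence** — «by considering the local structure on `U^top` consisting of connected open
  subsets of `U^top` that map isomorphically onto open subsets of `X^top`, one may construct a natural
  pre-Aut-holomorphic structure on `U^top` … by restricting the Aut-holomorphic structure of `𝕏`»: the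
  typed predicate `IsLiftedStructure` (`HolomorphicCores.lean`) had no existence lemma.  We prove
  `isLiftedStructure_ofCharted`: for EVERY holomorphic covering `p : U → X` of Riemann surfaces, the
  Aut-holomorphic structure of the complex structure of `U` (the one making `p` holomorphic) IS a lifted
  structure — a two-line consequence of the converse of Cor 2.3 (i)
  (`isLocalMorphism_ofCharted_of_isRCHolomorphic`, `AbsTopIII/RemarksArchimedeanLocalProofs`).
* **the functoriality clause** — «Finally, the asserted "functoriality" is with respect to finite étale
  morphisms of Aut-holomorphic spaces arising from hyperbolic curves over `ℂ`» (p.55 l.11–12).  For a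
  finite étale holomorphic `f : X′ → X` and a universal covering `p : U → X′` (so that `f ∘ p : U → X` is a
  universal covering of `X` by the SAME `𝕌`): (a) `Aut(U/X′) ≤ Aut(U/X)` is a finite-index inclusion of
  subgroups of `Aut(U^top)` (`deckGroup_le_deckGroup_comp`, `relIndex_deckGroup_comp_ne_zero`), so (b) the
  two injections into `Aut⁰(𝕌) ⊆ Aut(𝕌)` commute with it on the nose; (c) commensurable subgroups have
  the same commensurator (Mathlib `Subgroup.Commensurable.eq`), so the commensurator `Π`, the
  arithmeticity verdict `IsMargulisNonArithmetic` and the hyperbolic-core data `[𝕌/Π]` of `X′` and `X`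
  COINCIDE (`commensurator_subgroupOf_eq_of_relIndex_ne_zero`, `isMargulisNonArithmetic_iff_of_relIndex_ne_zero`).
  Assembled: `cor24_functorial` at print's binders, and `cor24_functorial_of_nonabelian_fundamentalGroup`
  at every finite holomorphic covering of connected second-countable Riemann surfaces of finite type with
  non-abelian fundamental group (the universal covering `𝔻 → X′` SUPPLIED, zero named facts).

Everything is stated directly as theorems (no `def … : Prop`).  Refereed pre-IUT material; classical
covering-space topology and group theory; nothing here bears on the disputed [IUTchIII] Cor. 3.12; no
side is taken.
-/

noncomputable section

namespace Literature.AnabelianGeometry.AbsoluteAnabelian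

open _root_.TopologicalSpace _root_.Topology _root_.Set _root_.Function
open scoped _root_.Manifold _root_.ContDiff
open Literature.Topology.CoveringSpaces
open Literature.Geometry.Kaehler.ComplexTorus (deckTransformations mem_deckTransformations_iff
  deck_eq_of_apply_eq)

universe u

/-! ### (b), first sentence: the charted structure of a holomorphic covering is a lifted structure -/

section Lifted

variable {X : Type u} [TopologicalSpace X] [ChartedSpace ℂ X] [IsManifold 𝓘(ℂ, ℂ) ω X]
  {U : Type u} [TopologicalSpace U] [ChartedSpace ℂ U] [IsManifold 𝓘(ℂ, ℂ) ω U]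

omit [IsManifold 𝓘(ℂ, ℂ) ω X] [IsManifold 𝓘(ℂ, ℂ) ω U] in
/-- A holomorphic map of Riemann surfaces is RC-holomorphic (holomorphic at every point).
[cite: MochizukiAbsTopIII2015, Definition 2.1 (ii) p.51] -/
theorem isRCHolomorphic_of_mdifferentiable {φ : U → X} (hφ : MDifferentiable 𝓘(ℂ, ℂ) 𝓘(ℂ, ℂ) φ) :
    IsRCHolomorphic φ :=
  fun _ => Or.inl (Filter.Eventually.of_forall fun y => hφ y)

/-- **[AbsTopIII] Cor 2.4 (b), first sentence — the lifted pre-Aut-holomorphic structure EXISTS and is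
the charted one.**  For every holomorphic covering map `p : U → X` of Riemann surfaces, the
Aut-holomorphic structure `𝒜_U` of the complex structure of `U` is a LIFTED STRUCTURE along `p` in the
typed sense `IsLiftedStructure`: `p` is a `(𝒰, 𝒲)`-local morphism `𝕌 → 𝕏` for `𝒰` the connected opens
of `U^top` on which `p` is injective («connected open subsets of `U^top` that map isomorphically onto
open subsets of `X^top`») and `𝒲` the connected opens of `X^top` — i.e. `𝒜_U|_𝒰` is obtained «by
restricting the Aut-holomorphic structure of `𝕏` on `X^top`».  Proof: a covering map is étale, a
holomorphic map is RC-holomorphic, and an étale RC-holomorphic map is a local morphism for every pair of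
local structures (converse of Cor 2.3 (i), `isLocalMorphism_ofCharted_of_isRCHolomorphic`).
[cite: MochizukiAbsTopIII2015, Corollary 2.4 (b) p.54] -/
theorem isLiftedStructure_ofCharted {p : U → X} (hp : IsCoveringMap p)
    (hpd : MDifferentiable 𝓘(ℂ, ℂ) 𝓘(ℂ, ℂ) p) :
    IsLiftedStructure (AutHolStructure.ofCharted X) p (AutHolStructure.ofCharted U) :=
  isLocalMorphism_ofCharted_of_isRCHolomorphic hp.isLocalHomeomorph
    (isRCHolomorphic_of_mdifferentiable hpd) _ _

/-- The same for ANY étale holomorphic map (not necessarily a covering), e.g. the restriction of a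
universal covering to an open subset. [cite: MochizukiAbsTopIII2015, Corollary 2.4 (b) p.54] -/
theorem isLiftedStructure_ofCharted_of_isLocalHomeomorph {p : U → X} (hp : IsLocalHomeomorph p)
    (hpd : MDifferentiable 𝓘(ℂ, ℂ) 𝓘(ℂ, ℂ) p) :
    IsLiftedStructure (AutHolStructure.ofCharted X) p (AutHolStructure.ofCharted U) :=
  isLocalMorphism_ofCharted_of_isRCHolomorphic hp (isRCHolomorphic_of_mdifferentiable hpd) _ _

end Lifted

/-! ### Deck groups of a composite covering `U → X′ → X` -/

section Deck

variable {X : Type u} [TopologicalSpace X] {X' : Type u} [TopologicalSpace X'] {U : Type u}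
  [TopologicalSpace U]

omit [TopologicalSpace X] [TopologicalSpace X'] in
/-- **(a), functoriality: `Aut(U/X′) ≤ Aut(U/X)`** — a deck transformation over `X′` is a deck
transformation over `X` for the composite covering `f ∘ p`.
[cite: MochizukiAbsTopIII2015, Corollary 2.4 (a) p.54] -/
theorem deckGroup_le_deckGroup_comp (f : X' → X) (p : U → X') :
    deckGroup p ≤ deckGroup (f ∘ p) := by
  intro γ hγ u
  simp only [Function.comp_apply]
  rw [(mem_deckTransformations_iff p γ).1 hγ u]

/-- **The deck group of a universal covering is transitive on fibres** (Hatcher Thm. 1.38 applied to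
`(p, p)`: two simply connected covers are isomorphic over the base through any two points of a fibre).
[cite: HatcherAT2002, §1.3 Thm. 1.38 (p. 67)] -/
theorem exists_mem_deckGroup_apply_eq [SimplyConnectedSpace U] [LocallyPathConnectedSpace U]
    {p : U → X'} (hp : IsCoveringMap p) {u u' : U} (h : p u = p u') :
    ∃ γ ∈ deckGroup p, γ u = u' := by
  obtain ⟨φ, hφu, hφ⟩ := exists_homeomorph_of_simplyConnected_covers hp hp u u' h
  exact ⟨φ, (mem_deckTransformations_iff p φ).2 hφ, hφu⟩

/-- **(a), functoriality: `Aut(U/X′)` has FINITE INDEX in `Aut(U/X)`** when `f : X′ → X` has finite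
fibres: the left cosets `γ · Aut(U/X′)` inject into the fibre `f ⁻¹ {f (p u₀)}` via `γ ↦ p (γ⁻¹ u₀)`
(well defined since `Aut(U/X′)` preserves `p`; injective since `Aut(U/X′)` is transitive on the fibres of
`p` and deck transformations over `X` agreeing at a point coincide).
[cite: MochizukiAbsTopIII2015, Corollary 2.4 (a) p.54] -/
theorem relIndex_deckGroup_comp_ne_zero [SimplyConnectedSpace U] [LocallyPathConnectedSpace U]
    {f : X' → X} {p : U → X'} (hp : IsCoveringMap p) (hq : IsCoveringMap (f ∘ p))
    (hfin : ∀ x, (f ⁻¹' {x}).Finite) :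
    (deckGroup p).relIndex (deckGroup (f ∘ p)) ≠ 0 := by
  classical
  set H := deckGroup p with hH
  set K := deckGroup (f ∘ p) with hK
  have hHK : H ≤ K := deckGroup_le_deckGroup_comp f p
  obtain ⟨u₀⟩ := (inferInstance : Nonempty U)
  -- the fibre of `f` through `p u₀`
  set F : Set X' := f ⁻¹' {f (p u₀)} with hF
  haveI : Finite F := (hfin (f (p u₀))).to_subtype
  -- the map on left cosets
  have hwd : ∀ γ δ : K, (QuotientGroup.leftRel (H.subgroupOf K)) γ δ →
      p (((γ : U ≃ₜ U))⁻¹ u₀) = p (((δ : U ≃ₜ U))⁻¹ u₀) := by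
    intro γ δ hγδ
    rw [QuotientGroup.leftRel_apply, Subgroup.mem_subgroupOf] at hγδ
    -- `γ⁻¹ δ ∈ H` preserves `p`
    have := (mem_deckTransformations_iff p _).1 hγδ ((δ : U ≃ₜ U)⁻¹ u₀)
    simpa [Subgroup.coe_mul, Subgroup.coe_inv, Homeomorph.mul_apply] using this
  have hmem : ∀ γ : K, p (((γ : U ≃ₜ U))⁻¹ u₀) ∈ F := by
    intro γ
    have hγ : ((γ : U ≃ₜ U))⁻¹ ∈ K := K.inv_mem γ.2
    show f (p (((γ : U ≃ₜ U))⁻¹ u₀)) = f (p u₀)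
    exact (mem_deckTransformations_iff (f ∘ p) _).1 hγ u₀
  let ψ : K ⧸ H.subgroupOf K → F :=
    Quotient.lift (fun γ : K => (⟨p (((γ : U ≃ₜ U))⁻¹ u₀), hmem γ⟩ : F))
      (fun γ δ hγδ => Subtype.ext (hwd γ δ hγδ))
  have hψ : Function.Injective ψ := by
    intro a b hab
    induction a using Quotient.inductionOn with
    | h γ =>
      induction b using Quotient.inductionOn with
      | h δ =>
        have hab' : p (((γ : U ≃ₜ U))⁻¹ u₀) = p (((δ : U ≃ₜ U))⁻¹ u₀) := by
          simpa [ψ] using congrArg Subtype.val hab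
        -- transitivity of `H` on the fibre of `p`
        obtain ⟨h, hh, hhu⟩ := exists_mem_deckGroup_apply_eq hp hab'
        -- `h γ⁻¹` and `δ⁻¹` are deck transformations over `X` agreeing at `u₀`
        have h1 : h * ((γ : U ≃ₜ U))⁻¹ ∈ K := K.mul_mem (hHK hh) (K.inv_mem γ.2)
        have h2 : ((δ : U ≃ₜ U))⁻¹ ∈ K := K.inv_mem δ.2
        haveI : PreconnectedSpace U := inferInstance
        have heq : h * ((γ : U ≃ₜ U))⁻¹ = ((δ : U ≃ₜ U))⁻¹ :=
          deck_eq_of_apply_eq hq h1 h2 (y := u₀) (by simpa [Homeomorph.mul_apply] using hhu)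
        apply Quotient.sound
        show QuotientGroup.leftRel (H.subgroupOf K) γ δ
        rw [QuotientGroup.leftRel_apply, Subgroup.mem_subgroupOf]
        -- `γ⁻¹ δ = h⁻¹ ∈ H`
        have : ((γ : U ≃ₜ U))⁻¹ * (δ : U ≃ₜ U) = h⁻¹ := by
          have := congrArg (fun x => h⁻¹ * x * (δ : U ≃ₜ U)) heq
          simpa [mul_assoc] using this
        simpa [Subgroup.coe_mul, Subgroup.coe_inv, this] using H.inv_mem hh
  haveI : Finite (K ⧸ H.subgroupOf K) := Finite.of_injective ψ hψ
  exact Subgroup.index_ne_zero_of_finite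

end Deck

/-! ### Group theory: a finite-index subgroup has the same commensurator -/

section Commensurator

variable {A : Type*} [Group A]

/-- Finite index `H ≤ K` makes `H`, `K` commensurable inside any ambient subgroup `G ≥ K`.
[cite: MochizukiAbsTopIII2015, Corollary 2.4 (c) p.55] -/
theorem commensurable_subgroupOf_of_relIndex_ne_zero {H K G : Subgroup A} (hHK : H ≤ K) (hKG : K ≤ G)
    (hidx : H.relIndex K ≠ 0) : Subgroup.Commensurable (H.subgroupOf G) (K.subgroupOf G) := by
  refine ⟨?_, ?_⟩
  · rwa [Subgroup.relIndex_subgroupOf hKG]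
  · rw [Subgroup.relIndex_subgroupOf (hHK.trans hKG), Subgroup.relIndex_eq_one.2 hHK]
    exact one_ne_zero

/-- **(c), functoriality of the commensurator `Π`**: for `H ≤ K ≤ G` with `[K : H] < ∞`, the
commensurators of `H` and of `K` in `G` coincide. [cite: MochizukiAbsTopIII2015, Corollary 2.4 (c) p.55] -/
theorem commensurator_subgroupOf_eq_of_relIndex_ne_zero {H K G : Subgroup A} (hHK : H ≤ K)
    (hKG : K ≤ G) (hidx : H.relIndex K ≠ 0) :
    Subgroup.Commensurable.commensurator (H.subgroupOf G) =
      Subgroup.Commensurable.commensurator (K.subgroupOf G) :=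
  Subgroup.Commensurable.eq (commensurable_subgroupOf_of_relIndex_ne_zero hHK hKG hidx)

/-- **(c), functoriality of (non-)arithmeticity**: for `H ≤ K ≤ G` with `[K : H] < ∞`, `H` is of finite
index in its commensurator in `G` iff `K` is (the commensurators being equal).
[cite: MochizukiAbsTopIII2015, Corollary 2.4 (c) p.55] -/
theorem isMargulisNonArithmetic_iff_of_relIndex_ne_zero {H K G : Subgroup A} (hHK : H ≤ K)
    (hKG : K ≤ G) (hidx : H.relIndex K ≠ 0) :
    IsMargulisNonArithmetic G H ↔ IsMargulisNonArithmetic G K := by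
  have hC := commensurator_subgroupOf_eq_of_relIndex_ne_zero hHK hKG hidx
  have hle : H.subgroupOf G ≤ K.subgroupOf G := fun x hx => by
    rw [Subgroup.mem_subgroupOf] at hx ⊢
    exact hHK hx
  have hidx' : (H.subgroupOf G).relIndex (K.subgroupOf G) ≠ 0 := by
    rwa [Subgroup.relIndex_subgroupOf hKG]
  constructor
  · rintro ⟨-, hH⟩
    refine ⟨hKG, ?_⟩
    rw [← hC]
    intro h0
    exact hH (Subgroup.relIndex_eq_zero_of_le_left hle h0)
  · rintro ⟨-, hK⟩
    refine ⟨hHK.trans hKG, ?_⟩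
    rw [hC]
    exact Subgroup.relIndex_ne_zero_trans hidx' hK

end Commensurator

/-! ### The functoriality clause of Cor 2.4, assembled -/

section Functorial

variable {X : Type} [TopologicalSpace X] [T2Space X] [ConnectedSpace X] [ChartedSpace ℂ X]
  [IsManifold 𝓘(ℂ, ℂ) ω X]
  {X' : Type} [TopologicalSpace X'] [T2Space X'] [ChartedSpace ℂ X'] [IsManifold 𝓘(ℂ, ℂ) ω X']
  {U : Type} [TopologicalSpace U] [SimplyConnectedSpace U] [ChartedSpace ℂ U]
  [IsManifold 𝓘(ℂ, ℂ) ω U]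

omit [T2Space X] [IsManifold 𝓘(ℂ, ℂ) ω X] [T2Space X'] [ChartedSpace ℂ X'] [IsManifold 𝓘(ℂ, ℂ) ω X']
  [IsManifold 𝓘(ℂ, ℂ) ω U] in
/-- A composite `U → X′ → X` of a universal covering of a Riemann surface `X′` and a covering `X′ → X`
of a connected Riemann surface is a (universal) covering of `X`.
[cite: HatcherAT2002, §1.3 Thm. 1.38 (p. 67)] -/
theorem isCoveringMap_comp_of_simplyConnected {f : X' → X} {p : U → X'} (hf : IsCoveringMap f)
    (hp : IsCoveringMap p) : IsCoveringMap (f ∘ p) := by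
  haveI := ChartedSpace.locallyPathConnectedSpace ℂ U
  haveI := Literature.Geometry.Kaehler.pathConnectedSpace_of_connectedSpace X
  haveI := Literature.Geometry.Kaehler.stronglyLocallyContractibleSpace_of_riemannSurface X
  exact hp.comp_of_simplyConnectedSpace hf

omit [T2Space X'] [IsManifold 𝓘(ℂ, ℂ) ω X'] in
/-- **[AbsTopIII] Cor 2.4, the functoriality clause** («the asserted "functoriality" is with respect to
finite étale morphisms of Aut-holomorphic spaces arising from hyperbolic curves over `ℂ`»), at print's
binders.  Let `f : X′ → X` be a finite étale holomorphic map of Riemann surfaces, `X` connected of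
finite type, and `p : U → X′` a surjective holomorphic universal covering by an Aut-holomorphic disc
`𝕌`.  Then `f ∘ p : U → X` is a surjective holomorphic universal covering of `X` by the same `𝕌`, and:
(a) `Aut(U/X′) ≤ Aut(U/X)` inside `Aut(U^top)`, of finite index; (b) both lie in `Aut⁰(𝕌)` — so the
natural injections `π₁ ↪ Aut⁰(𝕌) ⊆ Aut(𝕌)` of (b) commute with the inclusion of (a) on the nose;
(c) for `G = Aut⁰(𝕌)`, the commensurators `Π` of the two deck groups in `G` are EQUAL, `X′` is
non-arithmetic iff `X` is, and hence the hyperbolic-core data `[𝕌/Π]` of Cor 2.4 (c) (the subgroup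
`Pc = Π ≤ Aut(U^top)` with its action on `U^top`) are literally the same for `X′` and `X`.
[cite: MochizukiAbsTopIII2015, Corollary 2.4 p.55] -/
theorem cor24_functorial {f : X' → X} (hf : IsFiniteEtale f)
    (hfd : MDifferentiable 𝓘(ℂ, ℂ) 𝓘(ℂ, ℂ) f) {p : U → X'} (hp : IsCoveringMap p)
    (hps : Function.Surjective p) (hpd : MDifferentiable 𝓘(ℂ, ℂ) 𝓘(ℂ, ℂ) p) (hU : IsAutHolDisc U)
    (hX : IsOfFiniteType X) :
    (IsCoveringMap (f ∘ p) ∧ Function.Surjective (f ∘ p) ∧ MDifferentiable 𝓘(ℂ, ℂ) 𝓘(ℂ, ℂ) (f ∘ p)) ∧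
    (deckGroup p ≤ deckGroup (f ∘ p) ∧ (deckGroup p).relIndex (deckGroup (f ∘ p)) ≠ 0) ∧
    (((deckGroup p : Subgroup (U ≃ₜ U)) : Set (U ≃ₜ U)) ⊆ autIdComponent (AutHolStructure.ofCharted U) ∧
      ((deckGroup (f ∘ p) : Subgroup (U ≃ₜ U)) : Set (U ≃ₜ U)) ⊆
        autIdComponent (AutHolStructure.ofCharted U)) ∧
    ∀ G : Subgroup (U ≃ₜ U), (G : Set (U ≃ₜ U)) = autIdComponent (AutHolStructure.ofCharted U) →
      Subgroup.Commensurable.commensurator ((deckGroup p).subgroupOf G) =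
          Subgroup.Commensurable.commensurator ((deckGroup (f ∘ p)).subgroupOf G) ∧
        (IsMargulisNonArithmetic G (deckGroup p) ↔ IsMargulisNonArithmetic G (deckGroup (f ∘ p))) ∧
        (Subgroup.Commensurable.commensurator ((deckGroup p).subgroupOf G)).map G.subtype =
          (Subgroup.Commensurable.commensurator ((deckGroup (f ∘ p)).subgroupOf G)).map G.subtype := by
  haveI := ChartedSpace.locallyPathConnectedSpace ℂ U
  -- the composite universal covering
  have hq : IsCoveringMap (f ∘ p) := isCoveringMap_comp_of_simplyConnected hf.isCoveringMap hp
  haveI : Nonempty X' := Nonempty.map p inferInstance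
  have hfs : Function.Surjective f := hf.isCoveringMap.surjective_of_connectedSpace'
  have hqs : Function.Surjective (f ∘ p) := hfs.comp hps
  have hqd : MDifferentiable 𝓘(ℂ, ℂ) 𝓘(ℂ, ℂ) (f ∘ p) := hfd.comp hpd
  -- (a)
  have hle : deckGroup p ≤ deckGroup (f ∘ p) := deckGroup_le_deckGroup_comp f p
  have hidx : (deckGroup p).relIndex (deckGroup (f ∘ p)) ≠ 0 :=
    relIndex_deckGroup_comp_ne_zero hp hq hf.finite_fibre
  -- (b)
  have hK : ((deckGroup (f ∘ p) : Subgroup (U ≃ₜ U)) : Set (U ≃ₜ U)) ⊆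
      autIdComponent (AutHolStructure.ofCharted U) :=
    DeckGroupInAutIdComponent_holds X U (f ∘ p) hX hq hqs hqd hU
  have hH : ((deckGroup p : Subgroup (U ≃ₜ U)) : Set (U ≃ₜ U)) ⊆
      autIdComponent (AutHolStructure.ofCharted U) := fun γ hγ => hK (hle hγ)
  refine ⟨⟨hq, hqs, hqd⟩, ⟨hle, hidx⟩, ⟨hH, hK⟩, fun G hG => ?_⟩
  -- (c)
  have hKG : deckGroup (f ∘ p) ≤ G := by
    intro γ hγ
    have : γ ∈ (G : Set (U ≃ₜ U)) := by rw [hG]; exact hK hγ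
    exact this
  have hC := commensurator_subgroupOf_eq_of_relIndex_ne_zero hle hKG hidx
  exact ⟨hC, isMargulisNonArithmetic_iff_of_relIndex_ne_zero hle hKG hidx, by rw [hC]⟩

end Functorial

/-! ### The functoriality clause at genuine hyperbolic curves -/

section Genuine

variable (X : Type) [TopologicalSpace X] [T2Space X] [ConnectedSpace X] [ChartedSpace ℂ X]
  [IsManifold 𝓘(ℂ, ℂ) ω X]
  (X' : Type) [TopologicalSpace X'] [T2Space X'] [SecondCountableTopology X'] [ConnectedSpace X']
  [ChartedSpace ℂ X'] [IsManifold 𝓘(ℂ, ℂ) ω X']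

/-- **[AbsTopIII] Cor 2.4, the functoriality clause, at every finite étale holomorphic map
`f : X′ → X` of connected Riemann surfaces with `X` of finite type and `π₁(X′)` non-abelian** (all finite
étale morphisms of hyperbolic curves over `ℂ`): the universal covering `p : 𝔻 → X′` is SUPPLIED
(`exists_disc_covering_of_nonabelian_fundamentalGroup_holds`, zero named facts) and `cor24_functorial`
applies to it — `𝔻 → X′ → X` is the universal covering of `X`, `Aut(𝔻/X′) ≤ Aut(𝔻/X)` has finite
index inside `Aut⁰(𝔻)`, the commensurators, the arithmeticity verdicts and the core data agree.
[cite: MochizukiAbsTopIII2015, Corollary 2.4 p.55] -/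
theorem cor24_functorial_of_nonabelian_fundamentalGroup {f : X' → X} (hf : IsFiniteEtale f)
    (hfd : MDifferentiable 𝓘(ℂ, ℂ) 𝓘(ℂ, ℂ) f) (hX : IsOfFiniteType X) (x₀ : X')
    (hπ : ∃ a b : FundamentalGroup X' x₀, a * b ≠ b * a) :
    ∃ p : unitDiscOpens → X', IsCoveringMap p ∧ Function.Surjective p ∧
      MDifferentiable 𝓘(ℂ, ℂ) 𝓘(ℂ, ℂ) p ∧
      (IsCoveringMap (f ∘ p) ∧ Function.Surjective (f ∘ p) ∧
        MDifferentiable 𝓘(ℂ, ℂ) 𝓘(ℂ, ℂ) (f ∘ p)) ∧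
      (deckGroup p ≤ deckGroup (f ∘ p) ∧ (deckGroup p).relIndex (deckGroup (f ∘ p)) ≠ 0) ∧
      (((deckGroup p : Subgroup (unitDiscOpens ≃ₜ unitDiscOpens)) :
            Set (unitDiscOpens ≃ₜ unitDiscOpens)) ⊆
          autIdComponent (AutHolStructure.ofCharted unitDiscOpens) ∧
        ((deckGroup (f ∘ p) : Subgroup (unitDiscOpens ≃ₜ unitDiscOpens)) :
            Set (unitDiscOpens ≃ₜ unitDiscOpens)) ⊆
          autIdComponent (AutHolStructure.ofCharted unitDiscOpens)) ∧
      ∀ G : Subgroup (unitDiscOpens ≃ₜ unitDiscOpens),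
        (G : Set (unitDiscOpens ≃ₜ unitDiscOpens)) =
            autIdComponent (AutHolStructure.ofCharted unitDiscOpens) →
          Subgroup.Commensurable.commensurator ((deckGroup p).subgroupOf G) =
              Subgroup.Commensurable.commensurator ((deckGroup (f ∘ p)).subgroupOf G) ∧
            (IsMargulisNonArithmetic G (deckGroup p) ↔
              IsMargulisNonArithmetic G (deckGroup (f ∘ p))) ∧
            (Subgroup.Commensurable.commensurator ((deckGroup p).subgroupOf G)).map G.subtype =
              (Subgroup.Commensurable.commensurator ((deckGroup (f ∘ p)).subgroupOf G)).map
                G.subtype := by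
  obtain ⟨p, hp, hps, hpd⟩ := exists_disc_covering_of_nonabelian_fundamentalGroup_holds X' x₀ hπ
  haveI := simplyConnectedSpace_unitDiscOpens
  exact ⟨p, hp, hps, hpd, cor24_functorial hf hfd hp hps hpd isAutHolDisc_unitDiscOpens hX⟩

end Genuine

end Literature.AnabelianGeometry.AbsoluteAnabelian

end
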